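import Summits.QuantumFields.QCD.Theses.FemtoStepScaling
import Literature.MathematicalPhysics.QuantumFieldTheory.BoxMixingStepScaling
import HarnessLib.Audit

/-!
# Birth skeleton (BC3) for the crux `BoxMixingDecayR` (item stmt-QuantumFields-11449)

Route `FemtoStepScaling` (sub-problem QCD), crux decl
`Summit.QuantumFields.QCD.Theses.FemtoStepScaling.BoxMixingDecayR` (rev 1; rank 4; "THE LADDER'S OUTPUT",
card F2 ∧ F3: "σ exists and has no fixed point, so finitely many doublings pass any threshold"):

  for `N_f ∈ {2,3}` and every regularisation `reg` on a GOOD trajectory (leading-log mass scaling, two-loop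
  asymptotic scaling, `m_crit(k) > −1` eventually), IF the guarded finite-volume continuum limits with dynamical
  quarks exist (HYP_UV), THEN `∃ M₀, ∀ m > M₀, ∀ ε > 0, ∃ ℓ > 0, ∀ᶠ k, ` on the torus of side `2⌊ℓ/2a_k⌋₊ + 1`
  the `(−1)^F`-twisted partition function is `≠ 0` and the BOX MIXING (sup-normalised slab covariance across
  half the `ℓ`-hypercube, all bounded gluonic observables in the time slab `[0, ℓ/8]`) is `≤ ε`.

Registered by the skeleton-registrar seat `planner-skel-stmt-QuantumFields-11449-0` (route re-audit bin
REPAIRABLE, 2026-08-17) as `Cruxes/BoxMixingDecayR/Lines/birth.lean`.  It is the route-level BIRTH CERTIFICATE of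
the crux (≥ 2 named stubs, a kernel-checked composition concluding the crux BY NAME, `sorry` only inside `stub_*`),
deliberately LINE-NEUTRAL: it cuts the crux along the route header's own plan for it — the Lüscher–Weisz–Wolff
LADDER in mixing language, over the Literature objects the route had requested for exactly this purpose
(`Literature/MathematicalPhysics/QuantumFieldTheory/BoxMixingStepScaling.lean`: `boxMixing reg m k ℓ`, the
continuum profile `boxMixingProfile reg m ℓ = limsup_k boxMixing reg m k ℓ`, and the bridge
`forall_slab_le_iff_boxMixing_le` identifying the crux's inlined slab clause with `boxMixing ≤ ofReal ε`):

* `stub_twistedPartition : TwistedPartitionStmt` (F2, partition-function half; size M–L) — above a mass offset,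
  at every physical scale `ℓ ≥ ℓ₁`, the `(−1)^F`-twisted partition function `Z_k(ℓ) = ∫ ∏_f det(D_W + m_f(k)) dμ_W`
  of the `ℓ`-box is non-zero eventually in the cutoff (Wilson determinants are real by `γ₅`-hermiticity but
  SIGNED near `m_crit(k) < 0`: barrier `WilsonDeterminantSign`; no positivity is claimed, only `Z ≠ 0`).
* `stub_profileFinite : ProfileFiniteStmt` (F2, "σ exists": the step-scaling datum is a finite continuum
  quantity; size L) — above a mass offset, at every scale `ℓ ≥ ℓ₂`, `boxMixingProfile reg m ℓ ≠ ⊤`: the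
  sup-normalised slab covariances of the SIGNED normalised functional `qcdTorusExpect` stay bounded as `a_k → 0`
  at fixed physical volume (`|Ex A| ≤ sup |A|` is NOT automatic for a signed weight — refuter crux-attack
  2026-08-15; this is the cutoff-uniform bound on the sign quotient `∫|det| dμ / |∫ det dμ|` of the `ℓ`-box).
* `stub_noFixedPoint : NoFixedPointStmt` (F3, "σ has no fixed point"; open-problem — the crux's own
  why-it-might-fail lives here) — above a mass offset, for every positive mixing level `u` there are a
  contraction factor `θ < 1` and a scale `ℓ₃` beyond which ONE DOUBLING of the box contracts every finite
  continuum box mixing that is still `≥ u`: `ε(2ℓ) ≤ θ · ε(ℓ)` — the step-scaling map stays uniformly below the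
  diagonal on `[u, ∞)` (in the variable `z = −(8/3) log(ε/2)`: `σ(z) ≥ z + log θ⁻¹`, no fixed point at finite
  `z`; Lüscher–Weisz–Wolff 1991 §2, ALPHA N_f = 2, 3 running).  It does NOT give the crux by itself: with an
  infinite profile it is vacuous, and it says nothing about `Z ≠ 0`.

`BoxMixingDecayR_of : TwistedPartitionStmt → ProfileFiniteStmt → NoFixedPointStmt → BoxMixingDecayR` is
kernel-checked and is a genuine TERMINATION argument, not a conjunction seam: offset `M₀ = max (max M₁ M₂) M₃`;
for `m > M₀` and `ε > 0` take the level `u = ofReal ε`, the factor `θ(u) < 1`, the dyadic ladder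
`L n = 2ⁿ · max (max ℓ₁ ℓ₂) ℓ₃`; if every rung had profile `≥ u`, induction on the step gives
`ε(L n) ≤ θⁿ ε(L 0)` with `ε(L 0) < ⊤` (profile stub), and `θⁿ ε(L 0) → 0 < u` — contradiction; so some rung
`ℓ = L n` has `limsup_k boxMixing < ofReal ε`, hence eventually `boxMixing reg m k ℓ < ofReal ε`
(`eventually_boxMixing_lt`), which the bridge lemma turns into the crux's inlined slab clause, while the
partition stub supplies `Z ≠ 0` eventually at the same `ℓ ≥ ℓ₁`.  `boxMixingDecayR_of_stubs : BoxMixingDecayR`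
instantiates it.

## Negative knowledge honoured (read 2026-08-17)
* `Cruxes/BoxMixingDecayR/` had NO workfiles before this one (no `Disproof.lean`, no dead lines, no ideas);
  the crux's evidence is the refuter crux-attack EVIDENCE_BoxMixingDecayR.md (SURVIVES; GOOD inhabited by
  `QCDRegularisation.canonicalAF`; HYP_UV not junk-inhabited; asymptotic scaling load-bearing; "small ℓ =
  periodic femto box, mixing ≈ 2" — which is why the ladder STARTS at a finite, not a small, value and why no
  femto smallness is claimed on the periodic boxes of this crux).
* `ledger negatives --problem QuantumFields` (5 entries: RobustYangMillsRG stmt-14958, MirrorModularBoosts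
  stmt-9665, AdaptiveCoarseSystem stmt-9494, MultibosonLatticeGap stmt-9599, AdmissibleRootsExist stmt-9603) —
  none concerns box mixing / step scaling; lesson applied: no bespoke admissibility predicate, no hand-picked
  constant (`θ < 1`, offsets and scales existential — typing checklist 4c (iv)), every stub phrased over the
  crux's own clauses (`Good`, `HypUV`, `TwistedZNeZero` are VERBATIM copies of the crux's sub-formulas) and the
  requested Literature objects.
* Junk values: `boxMixingProfile` lives in `ℝ≥0∞` (no side condition); `= ⊤` is exactly what `stub_profileFinite`
  excludes and what makes `stub_noFixedPoint` alone vacuous; `qcdTorusExpect` is junk `0` when `Z = 0`, which is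
  why `Z ≠ 0` is its own stub and a conjunct of the crux.

## BC3 probes (planner folder `bc/`): for each stub statement `S`, `S → BoxMixingDecayR` and `S → QCD` by
`first | exact? | simpa | aesop` FAIL (files `bc/probe_<stub>_{crux,summit}.lean`; rc and goals in NOTES.md).
-/

noncomputable section

namespace Summit.QuantumFields.QCD.Cruxes.BoxMixingDecayR.Birth

open scoped BigOperators Topology Classical ENNReal
open MeasureTheory Filter
open Literature.MathematicalPhysics.QuantumFieldTheory
open Literature.MathematicalPhysics.QuantumLattice
open Literature.Probability.LatticeModels (box)
open Summit.QuantumFields.QCD.Theses.FemtoStepScaling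

/-! ## §0 Currency — verbatim sub-formulas of the crux -/

/-- **GOOD trajectory** (verbatim the crux's trajectory hypothesis): leading-log mass scaling, two-loop
asymptotic scaling `β_k − afBeta N_f Λ a_k → 0` for some `Λ > 0`, and `m_crit(k) > −1` eventually. -/
def Good (Nf : ℕ) (reg : QCDRegularisation Nf) : Prop :=
  reg.HasMassScaling ∧
    (∃ Λ > 0, Tendsto (fun k => reg.β k - afBeta Nf Λ (reg.a k)) atTop (nhds 0)) ∧
      (∀ᶠ k in atTop, (-1 : ℝ) < reg.mcrit k)

/-- **HYP_UV** (verbatim the crux's ultraviolet hypothesis = the guarded finite-volume continuum limits of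
`FiniteVolumeContinuumLimitC` with dynamical quarks): for every positive mass tuple there are species
renormalisations `z, shift`, a limit functional `W` and `ℓ₀ > 0` such that on every physical torus of side
`ℓ ≥ ℓ₀` the smeared renormalised `n`-point functions with pairwise-disjoint closed supports converge under
`qcdTorusExpect`, and every flavour-changing pseudoscalar has a non-factorising time-separated two-point value. -/
def HypUV (Nf : ℕ) (reg : QCDRegularisation Nf) : Prop :=
  ∀ m : Fin Nf → ℝ, (∀ fl, 0 < m fl) → ∃ z shift : QCDField Nf → ℕ → ℝ,
    ∃ W : ((ℓ : ℝ) → (n : ℕ) → (Fin n → QCDField Nf) →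
      (Fin n → SchwartzMap (EuclideanSpace ℝ (Fin 4)) ℝ) → ℂ), ∃ ℓ₀ > 0,
      (∀ ℓ : ℝ, ℓ₀ ≤ ℓ → ∀ (n : ℕ) (σ : Fin n → QCDField Nf)
        (f : Fin n → SchwartzMap (EuclideanSpace ℝ (Fin 4)) ℝ),
        (∀ i j : Fin n, i ≠ j → Disjoint (tsupport (f i)) (tsupport (f j))) →
          Tendsto (fun k => qcdTorusExpect (reg.β k) (2 * ⌊ℓ / (2 * reg.a k)⌋₊ + 1)
            (fun fl => (reg.scheme m 0 0).mq fl k)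
            (fun U => (List.ofFn fun i : Fin n => (∑ x ∈ box 4 ⌊ℓ / (2 * reg.a k)⌋₊,
              ((z (σ i) k * reg.a k ^ 4 * (f i) (reg.a k • siteToE x) : ℝ) : ℂ) •
                (insertion U (σ i) x - algebraMap ℂ _ (((shift (σ i) k) : ℝ) : ℂ)))).prod))
            atTop (nhds (W ℓ n σ f))) ∧
      (∀ fl gl : Fin Nf, fl ≠ gl → ∃ ℓ : ℝ, ℓ₀ ≤ ℓ ∧
        ∃ f g : SchwartzMap (EuclideanSpace ℝ (Fin 4)) ℝ,
          tsupport f ⊆ {x | x 0 < 0} ∧ tsupport g ⊆ {x | 0 < x 0} ∧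
            W ℓ 2 (fun _ => QCDField.pseudoRe fl gl) ![f, g] ≠
              W ℓ 1 (fun _ => QCDField.pseudoRe fl gl) ![f] * W ℓ 1 (fun _ => QCDField.pseudoRe fl gl) ![g])

/-- **The `(−1)^F`-twisted partition function of the `ℓ`-box at cutoff step `k` is non-zero** (verbatim the
first conjunct of the crux's conclusion, with its 'let-via-∀' binder `S = ⌊ℓ/(2a_k)⌋₊`):
`∫ ∏_f det(D_W[U] + m_f(k)) dμ_W(U) ≠ 0` on the torus of side `2S+1` at `β_k`. -/
def TwistedZNeZero {Nf : ℕ} (reg : QCDRegularisation Nf) (m : Fin Nf → ℝ) (ℓ : ℝ) (k : ℕ) : Prop :=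
  ∀ S : ℕ, S = ⌊ℓ / (2 * reg.a k)⌋₊ →
    (∫ U, fermiIntegral (fermiBoltzmann U (fun fl => (reg.scheme m 0 0).mq fl k))
        ∂(wilsonMeasure (d := 4) (L := (2 * S + 1)) (fundamentalRep (Fin 3)) (reg.β k))) ≠ 0

/-! ## §1 The three stub statements -/

/-- **(F2a) Non-vanishing of the twisted partition function along the ladder** (size M–L).  For
`N_f ∈ {2,3}` and every GOOD `reg` with HYP_UV there is a mass offset `M₁` such that for every tuple above
`M₁` there is `ℓ₁ > 0` with: for every physical scale `ℓ ≥ ℓ₁`, eventually in `k`, `Z_k(ℓ) ≠ 0`.  Why plausibly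
true: each Wilson determinant is real, positive for bare masses `> 0` and for the heavy modes, and the product
over flavours of an honest finite-volume continuum QCD is expected non-degenerate; `N_f = 2` degenerate tuples
have `det² ≥ 0` and `Z > 0` outright.  Why it might fail: bare masses sit at `m_crit(k) + a_k m_f/Z_m(k) < 0`
eventually, where single determinants DO change sign (barrier `WilsonDeterminantSign`), and nothing forbids an
exact cancellation at isolated `k` for non-degenerate tuples — the claim is only `eventually in k`. -/
def TwistedPartitionStmt : Prop :=
  ∀ (Nf : ℕ) (reg : QCDRegularisation Nf), 2 ≤ Nf → Nf ≤ 3 → Good Nf reg → HypUV Nf reg →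
    ∃ M₁ : ℝ, ∀ m : Fin Nf → ℝ, (∀ fl, M₁ < m fl) →
      ∃ ℓ₁ > 0, ∀ ℓ : ℝ, ℓ₁ ≤ ℓ → ∀ᶠ k in atTop, TwistedZNeZero reg m ℓ k

/-- **(F2b) "σ exists": the continuum box-mixing profile is finite at every large scale** (size L).  For
`N_f ∈ {2,3}` and every GOOD `reg` with HYP_UV there is a mass offset `M₂` such that for every tuple above `M₂`
there is `ℓ₂ > 0` with `boxMixingProfile reg m ℓ ≠ ⊤` for every `ℓ ≥ ℓ₂` — i.e. `limsup_{k→∞}` of the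
sup over pairs of bounded (`sup ≤ 1`) gluonic slab observables of `‖⟨A · τ B⟩ − ⟨A⟩⟨τ B⟩‖` under the signed
normalised functional `qcdTorusExpect` on the `ℓ`-box is finite.  Why plausibly true: `‖Ex F‖ ≤ R_k sup|F|`
with the sign quotient `R_k = ∫|∏ det| dμ / |∫ ∏ det dμ|`, and at fixed physical volume the continuum limit of
lattice QCD with Wilson quarks is expected to have a bounded sign quotient (Lüscher transfer-matrix positivity
for `m_crit > −1` plus twisted-trace corrections; trivially `R = 1` for `N_f = 2` degenerate).  Why it might
fail: a genuine finite-volume sign problem (`R_k → ∞` as the number of sites `(ℓ/a_k)⁴ → ∞`) for split tuples /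
`N_f = 3`; HYP_UV controls smeared field correlators, not the sign quotient. -/
def ProfileFiniteStmt : Prop :=
  ∀ (Nf : ℕ) (reg : QCDRegularisation Nf), 2 ≤ Nf → Nf ≤ 3 → Good Nf reg → HypUV Nf reg →
    ∃ M₂ : ℝ, ∀ m : Fin Nf → ℝ, (∀ fl, M₂ < m fl) →
      ∃ ℓ₂ > 0, ∀ ℓ : ℝ, ℓ₂ ≤ ℓ → boxMixingProfile reg m ℓ ≠ ⊤

/-- **(F3) "σ has no fixed point": uniform contraction under one doubling above every positive level**
(open-problem — the infrared core).  For `N_f ∈ {2,3}` and every GOOD `reg` with HYP_UV there is a mass offset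
`M₃` such that for every tuple above `M₃` and every level `u > 0` there are `θ < 1` and `ℓ₃ > 0` with: for
every `ℓ ≥ ℓ₃` whose continuum box mixing is finite and still `≥ u`, `boxMixingProfile reg m (2ℓ) ≤ θ ·
boxMixingProfile reg m ℓ`.  In the step variable `z = −(8/3) log(ε/2)` this reads `σ(z) ≥ z + log θ⁻¹` on
`{z ≤ z(u)}`: the step-scaling function stays uniformly above the diagonal at finite `z` — NO INFRARED FIXED
POINT ("the box eventually exceeds the correlation length").  Why plausibly true: `N_f = 2, 3` lie below every
estimate of the conformal window, the ALPHA `N_f = 2, 3` couplings run monotonically, and a massive theory has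
`ε(2ℓ)/ε(ℓ) ≈ e^{−3m(ℓ)ℓ/8} → 0`.  Why it might fail: this is the gap conjecture in finite-size form —
`σ(u) > u` is provable only perturbatively (small `u`, asymptotic freedom), no monotone quantity in `ℓ` is known
beyond PT, and the statement is asked for EVERY GOOD `reg` (mis-tuned `m_crit` ⇒ pure Yang–Mills boxes). -/
def NoFixedPointStmt : Prop :=
  ∀ (Nf : ℕ) (reg : QCDRegularisation Nf), 2 ≤ Nf → Nf ≤ 3 → Good Nf reg → HypUV Nf reg →
    ∃ M₃ : ℝ, ∀ m : Fin Nf → ℝ, (∀ fl, M₃ < m fl) →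
      ∀ u : ℝ≥0∞, 0 < u → ∃ θ : ℝ≥0∞, θ < 1 ∧ ∃ ℓ₃ > 0, ∀ ℓ : ℝ, ℓ₃ ≤ ℓ →
        u ≤ boxMixingProfile reg m ℓ → boxMixingProfile reg m ℓ ≠ ⊤ →
          boxMixingProfile reg m (2 * ℓ) ≤ θ * boxMixingProfile reg m ℓ

/-! ## §2 The registered stubs (the ONLY `sorry`s of this file) -/

/-- (F2a) twisted partition function non-zero along the ladder — size M–L. -/
theorem stub_twistedPartition : TwistedPartitionStmt := by
  sorry

/-- (F2b) "σ exists": finite continuum box-mixing profile at every large scale — size L. -/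
theorem stub_profileFinite : ProfileFiniteStmt := by
  sorry

/-- (F3) "σ has no fixed point": uniform contraction under doubling above every positive level —
open-problem. -/
theorem stub_noFixedPoint : NoFixedPointStmt := by
  sorry

/-! ## §3 Composition (kernel-checked; no `sorry` below this line) -/

/-- **Termination of the dyadic ladder** (pure `ℝ≥0∞` bookkeeping, proved): if a profile `P : ℝ → ℝ≥0∞` is
finite at every rung `2ⁿ L₀` and one doubling contracts it by `θ < 1` from every rung at which it is finite and
`≥ u > 0`, then some rung has `P (2ⁿ L₀) < u`. [folklore] -/
theorem exists_rung_lt {P : ℝ → ℝ≥0∞} {L₀ : ℝ} {u θ : ℝ≥0∞} (hu : 0 < u) (hθ : θ < 1)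
    (hfin : ∀ n : ℕ, P (2 ^ n * L₀) ≠ ⊤)
    (hstep : ∀ n : ℕ, u ≤ P (2 ^ n * L₀) → P (2 ^ n * L₀) ≠ ⊤ →
      P (2 * (2 ^ n * L₀)) ≤ θ * P (2 ^ n * L₀)) :
    ∃ n : ℕ, P (2 ^ n * L₀) < u := by
  by_contra hex
  have hcon : ∀ n : ℕ, u ≤ P (2 ^ n * L₀) := fun n => not_lt.1 fun h => hex ⟨n, h⟩
  have hind : ∀ n : ℕ, P (2 ^ n * L₀) ≤ θ ^ n * P (2 ^ 0 * L₀) := by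
    intro n
    induction n with
    | zero => simp
    | succ n ih =>
      have h2 : (2 : ℝ) ^ (n + 1) * L₀ = 2 * (2 ^ n * L₀) := by rw [pow_succ]; ring
      calc P (2 ^ (n + 1) * L₀) = P (2 * (2 ^ n * L₀)) := by rw [h2]
        _ ≤ θ * P (2 ^ n * L₀) := hstep n (hcon n) (hfin n)
        _ ≤ θ * (θ ^ n * P (2 ^ 0 * L₀)) := by gcongr
        _ = θ ^ (n + 1) * P (2 ^ 0 * L₀) := by rw [← mul_assoc, ← pow_succ']
  have htend : Tendsto (fun n : ℕ => θ ^ n * P (2 ^ 0 * L₀)) atTop (𝓝 0) := by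
    have h := ENNReal.Tendsto.mul_const (ENNReal.tendsto_pow_atTop_nhds_zero_iff.2 hθ)
      (Or.inr (hfin 0))
    simpa only [zero_mul] using h
  obtain ⟨n, hn⟩ := (htend.eventually (gt_mem_nhds hu)).exists
  exact lt_irrefl u ((hcon n).trans_lt ((hind n).trans_lt hn))

/-- **The crux from the three stubs** (concludes `BoxMixingDecayR` BY NAME).  Offset `max (max M₁ M₂) M₃`;
level `u = ofReal ε`; dyadic ladder from `max (max ℓ₁ ℓ₂) ℓ₃`; `exists_rung_lt` gives a rung with profile
`< ofReal ε`; `eventually_boxMixing_lt` makes the lattice box mixing `< ofReal ε` eventually in `k`; the bridge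
`forall_slab_le_iff_boxMixing_le` rewrites that as the crux's inlined slab clause; the partition stub gives
`Z ≠ 0` eventually at the same scale. -/
theorem BoxMixingDecayR_of :
    TwistedPartitionStmt → ProfileFiniteStmt → NoFixedPointStmt → BoxMixingDecayR := by
  intro hZ hF hN Nf reg h2 h3 hgood hUV
  obtain ⟨M₁, hM₁⟩ := hZ Nf reg h2 h3 hgood hUV
  obtain ⟨M₂, hM₂⟩ := hF Nf reg h2 h3 hgood hUV
  obtain ⟨M₃, hM₃⟩ := hN Nf reg h2 h3 hgood hUV
  refine ⟨max (max M₁ M₂) M₃, fun m hm ε hε => ?_⟩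
  have hm₁ : ∀ fl, M₁ < m fl := fun fl =>
    lt_of_le_of_lt ((le_max_left _ _).trans (le_max_left _ _)) (hm fl)
  have hm₂ : ∀ fl, M₂ < m fl := fun fl =>
    lt_of_le_of_lt ((le_max_right _ _).trans (le_max_left _ _)) (hm fl)
  have hm₃ : ∀ fl, M₃ < m fl := fun fl => lt_of_le_of_lt (le_max_right _ _) (hm fl)
  obtain ⟨ℓ₁, hℓ₁, hZ₁⟩ := hM₁ m hm₁
  obtain ⟨ℓ₂, hℓ₂, hF₂⟩ := hM₂ m hm₂
  have hu : (0 : ℝ≥0∞) < ENNReal.ofReal ε := ENNReal.ofReal_pos.2 hε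
  obtain ⟨θ, hθ, ℓ₃, hℓ₃, hN₃⟩ := hM₃ m hm₃ (ENNReal.ofReal ε) hu
  -- the dyadic ladder from `L₀ = max (max ℓ₁ ℓ₂) ℓ₃`
  set L₀ : ℝ := max (max ℓ₁ ℓ₂) ℓ₃ with hL₀_def
  have hL₀ : 0 < L₀ := lt_of_lt_of_le hℓ₁ ((le_max_left _ _).trans (le_max_left _ _))
  have hrung : ∀ n : ℕ, L₀ ≤ 2 ^ n * L₀ := fun n =>
    le_mul_of_one_le_left hL₀.le (one_le_pow₀ (by norm_num))
  have hr₁ : ∀ n : ℕ, ℓ₁ ≤ 2 ^ n * L₀ := fun n =>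
    ((le_max_left _ _).trans (le_max_left _ _)).trans (hrung n)
  have hr₂ : ∀ n : ℕ, ℓ₂ ≤ 2 ^ n * L₀ := fun n =>
    ((le_max_right _ _).trans (le_max_left _ _)).trans (hrung n)
  have hr₃ : ∀ n : ℕ, ℓ₃ ≤ 2 ^ n * L₀ := fun n => (le_max_right _ _).trans (hrung n)
  obtain ⟨n, hn⟩ := exists_rung_lt (P := fun ℓ => boxMixingProfile reg m ℓ) hu hθ
    (fun n => hF₂ _ (hr₂ n)) (fun n hun hfn => hN₃ _ (hr₃ n) hun hfn)
  refine ⟨2 ^ n * L₀, lt_of_lt_of_le hL₀ (hrung n), ?_⟩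
  filter_upwards [hZ₁ _ (hr₁ n), eventually_boxMixing_lt hn] with k hZk hmk
  intro S hS
  exact ⟨hZk S hS, (forall_slab_le_iff_boxMixing_le reg m k (2 ^ n * L₀) hε.le).2 hmk.le S hS⟩

/-- The crux along this skeleton, from the registered stubs (sorries only inside `stub_*`). -/
theorem boxMixingDecayR_of_stubs : BoxMixingDecayR :=
  BoxMixingDecayR_of stub_twistedPartition stub_profileFinite stub_noFixedPoint

end Summit.QuantumFields.QCD.Cruxes.BoxMixingDecayR.Birth

end
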